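import Summits.CriticalPhenomena.CardyFormulaZ2.Theorems.CardySusyWardParafermionFamiliesToSLESixCornerFormStructureB

/-!
# The corner (dart) form of the `q = 1` parafermionic observable: exact closedness at inner medial
# vertices and the boundary laws, along admissible discretisation families (stub `stub_cornerFormStructure`)

Helper file for the crux `CardySusyWard.ParafermionFamiliesToSLESix` (stmt-CriticalPhenomena-10814),
line `exact-potential-schwarz-christoffel`, stub `stub_cornerFormStructure`, in TREE vocabulary
(`cornerFormStructure_tree`; the skeleton-local `cornerObs / openPhase / closedPhase / connA / dartProb`
are replaced by `QkzStripBoundaryArm.cornerObs (Λ δ) δ`, `FinitaryGreenPairing.cornerPhase δ (Λ δ) · ·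
univ / ∅` and the two `P_{1/2}`-probabilities written out, `e₀, e₁` by `Pi.single 0 1, Pi.single 1 1`).

**Theorem** (`cornerFormStructure_tree`).  With `c = i`: for every Dobrushin domain `D` and every family
`Λ` with the six family fields (`IsFamily`), eventually as `δ → 0⁺`:
(a)/(a′) at every lattice edge `{x, x + eᵢ}` of `Ω_δ` with no endpoint on the discrete arcs, the four
corner observables obey `F(NW) - F(SE) = i (F(NE) - F(SW))` (Duminil-Copin 2012, Prop. 4: the tree's
`halfCRVertexRelation_of_dobrushinDomain` when the faces at `x` are inner — `faces_dichotomy` — and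
`0 = 0` otherwise, corners of non-inner faces being never traversed);
(b) darts at sites of the dual-wired arc are never traversed;
(c) the free-arc touch law and (d) the wired-arc law of `…CornerFormStructureB.lean`
(Duminil-Copin 2012, Prop. 5), whose extra hypotheses in the skeleton's phrasing are not needed.
-/

noncomputable section

namespace Summit.CriticalPhenomena.CardyFormulaZ2.Theorems.ParafermionFamiliesToSLESix.StripAnchored

open MeasureTheory Filter Set
open scoped Topology
open Literature.Probability.Percolation (bondPercolation half BondConfig openGraph)
open Literature.Probability.LatticeModels
open Literature.Probability.RandomPlanarGeometry (DobrushinDomain)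
open Literature.Barriers.CriticalPhenomena (medialCornersAt medialVertexOf HalfCRRelationAt isCorner_medialCornersAt)
open Summit.CriticalPhenomena.CardyFormulaZ2.Cruxes.EdgePrecompact.QkzStripBoundaryArm (cornerObs)
open Summit.CriticalPhenomena.CardyFormulaZ2.Cruxes.CoherentMorera.FinitaryGreenPairing (cornerPhase)
open Summit.CriticalPhenomena.CardyFormulaZ2.Theorems.ParafermionPrecompact.Negative (IsFamily)

namespace CornerForm

/-! ## Clause (a): the half-CR relation at an edge off the arcs -/

/-- **Clause (a) at one datum.** For an admissible discretisation `E` of a Dobrushin domain and a lattice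
edge `s(x, x + eᵢ)` of `Ω_δ` with no endpoint on the discrete arcs, the half-CR relation with coefficient
`i` holds at `(x, i)` for the corner observable read at any mesh `δ > 0`: if the faces at `x` are inner
this is Duminil-Copin's Prop. 4 (`halfCRVertexRelation_of_dobrushinDomain`), otherwise none of them is
(`faces_dichotomy`) and all four corner observables vanish. [cite: DuminilCopin2012Parafermion, Proposition 4] -/
theorem halfCR_offArcs (D : DobrushinDomain) (E : DiscreteDobrushin) (hΩ : E.Ω = D.carrier) (hE : E.IsZdAdmissible)
    (x : Site 2) (i : Fin 2) (he : s(x, x + Pi.single i 1) ∈ (discreteDomainGraph E.Ω E.δ).edgeSet)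
    (hxA : x ∉ E.zdArcA) (hxB : x ∉ E.zdArcB) (hxA' : x + Pi.single i 1 ∉ E.zdArcA)
    (hxB' : x + Pi.single i 1 ∉ E.zdArcB) (δ : ℝ) (hδ : 0 < δ) :
    HalfCRRelationAt Complex.I (fun c : Site 2 × Site 2 => cornerObs E δ c.1 c.2) (x, i) := by
  have hxb : x ∉ E.zdBoundary := fun h => by
    rcases hE.zdBoundary_subset h with h | h
    exacts [hxA h, hxB h]
  rcases E.faces_dichotomy hxb with hall | hnone
  · refine halfCRVertexRelation_of_dobrushinDomain D E hΩ hE (x, i) ⟨he, ?_, ?_⟩ δ hδ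
    · intro y hy
      rcases Sym2.mem_iff.1 hy with rfl | rfl
      exacts [⟨hxA, hxB⟩, ⟨hxA', hxB'⟩]
    · intro f hf _
      obtain ⟨j, rfl⟩ := exists_faceAt_of_isCorner hf
      exact hall j
  · -- the face of each of the four corners is a face around `x` (the landed form of this remark,
    -- `…SymmetryUpgradeR.ZhouRotationSplitAudit.isCorner_fst_medialCornersAt`, lives in another route's
    -- cone and is not imported, to keep this cone small)
    have hleft : ∀ k : Fin 4, IsCorner x (medialCornersAt x i k).2 := by
      intro k
      fin_cases i <;> fin_cases k <;> intro j <;> fin_cases j <;> simp [medialCornersAt]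
    have h0 : ∀ k : Fin 4, cornerObs E δ (medialCornersAt x i k).1 (medialCornersAt x i k).2 = 0 := by
      intro k
      obtain ⟨j, hj⟩ := exists_faceAt_of_isCorner (hleft k)
      exact cornerObs_eq_zero_of_not_isInnerFace hE δ (isCorner_medialCornersAt x i k) (hj ▸ hnone j)
    unfold HalfCRRelationAt
    simp only [h0, sub_self, mul_zero]

/-- Clause (a) at a horizontal edge, corners written out (`NW, NE, SE, SW = (x,x), (x+e₀,x), (x+e₀,x-e₁), (x,x-e₁)`).
[cite: DuminilCopin2012Parafermion, Proposition 4] -/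
theorem halfCR_horizontal (D : DobrushinDomain) (E : DiscreteDobrushin) (hΩ : E.Ω = D.carrier) (hE : E.IsZdAdmissible)
    (x : Site 2) (he : s(x, x + Pi.single 0 1) ∈ (discreteDomainGraph E.Ω E.δ).edgeSet)
    (hxA : x ∉ E.zdArcA) (hxB : x ∉ E.zdArcB) (hxA' : x + Pi.single 0 1 ∉ E.zdArcA)
    (hxB' : x + Pi.single 0 1 ∉ E.zdArcB) (δ : ℝ) (hδ : 0 < δ) :
    cornerObs E δ x x - cornerObs E δ (x + Pi.single 0 1) (x - Pi.single 1 1) =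
      Complex.I * (cornerObs E δ (x + Pi.single 0 1) x - cornerObs E δ x (x - Pi.single 1 1)) :=
  halfCR_offArcs D E hΩ hE x 0 he hxA hxB hxA' hxB' δ hδ

/-- Clause (a′) at a vertical edge, corners written out (`NW, NE, SE, SW = (x+e₁,x-e₀), (x+e₁,x), (x,x), (x,x-e₀)`,
the relation multiplied by `-1`). [cite: DuminilCopin2012Parafermion, Proposition 4] -/
theorem halfCR_vertical (D : DobrushinDomain) (E : DiscreteDobrushin) (hΩ : E.Ω = D.carrier) (hE : E.IsZdAdmissible)
    (x : Site 2) (he : s(x, x + Pi.single 1 1) ∈ (discreteDomainGraph E.Ω E.δ).edgeSet)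
    (hxA : x ∉ E.zdArcA) (hxB : x ∉ E.zdArcB) (hxA' : x + Pi.single 1 1 ∉ E.zdArcA)
    (hxB' : x + Pi.single 1 1 ∉ E.zdArcB) (δ : ℝ) (hδ : 0 < δ) :
    cornerObs E δ x x - cornerObs E δ (x + Pi.single 1 1) (x - Pi.single 0 1) =
      Complex.I * (cornerObs E δ x (x - Pi.single 0 1) - cornerObs E δ (x + Pi.single 1 1) x) := by
  have h : cornerObs E δ (x + Pi.single 1 1) (x - Pi.single 0 1) - cornerObs E δ x x =
      Complex.I * (cornerObs E δ (x + Pi.single 1 1) x - cornerObs E δ x (x - Pi.single 0 1)) :=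
    halfCR_offArcs D E hΩ hE x 1 he hxA hxB hxA' hxB' δ hδ
  linear_combination -h

end CornerForm

/-! ## The stub, along admissible families -/

/-- **`stub_cornerFormStructure` in tree vocabulary** (line `exact-potential-schwarz-christoffel` of the
crux `ParafermionFamiliesToSLESix`): with the universal coefficient `c = i`, for every Dobrushin domain
and every family with the six family fields, eventually in `δ`: (a)/(a′) exact closedness of the corner
form at the lattice edges of `Ω_δ` off the discrete arcs (Duminil-Copin 2012, Prop. 4), (b) darts at
sites of the dual-wired arc are never traversed, (c) the free-arc touch law and (d) the wired-arc law
(Duminil-Copin 2012, Prop. 5) for the tree's corner observable `cornerObs (Λ δ) δ`, the phases being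
the integrands `cornerPhase` of the all-open / all-closed configuration.
[cite: DuminilCopin2012Parafermion, Propositions 4 and 5] -/
theorem cornerFormStructure_tree : ∃ c : ℂ, (c = Complex.I ∨ c = -Complex.I) ∧ ∀ (D : DobrushinDomain) (Λ : ℝ → DiscreteDobrushin), IsFamily D Λ → ∀ᶠ δ in 𝓝[>] (0:ℝ), (∀ x : Site 2, s(x, x + Pi.single 0 1) ∈ (discreteDomainGraph (Λ δ).Ω (Λ δ).δ).edgeSet → x ∉ (Λ δ).zdArcA → x ∉ (Λ δ).zdArcB → x + Pi.single 0 1 ∉ (Λ δ).zdArcA → x + Pi.single 0 1 ∉ (Λ δ).zdArcB → cornerObs (Λ δ) δ x x - cornerObs (Λ δ) δ (x + Pi.single 0 1) (x - Pi.single 1 1) = c * (cornerObs (Λ δ) δ (x + Pi.single 0 1) x - cornerObs (Λ δ) δ x (x - Pi.single 1 1))) ∧ (∀ x : Site 2, s(x, x + Pi.single 1 1) ∈ (discreteDomainGraph (Λ δ).Ω (Λ δ).δ).edgeSet → x ∉ (Λ δ).zdArcA → x ∉ (Λ δ).zdArcB → x + Pi.single 1 1 ∉ (Λ δ).zdArcA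 → x + Pi.single 1 1 ∉ (Λ δ).zdArcB → cornerObs (Λ δ) δ x x - cornerObs (Λ δ) δ (x + Pi.single 1 1) (x - Pi.single 0 1) = c * (cornerObs (Λ δ) δ x (x - Pi.single 0 1) - cornerObs (Λ δ) δ (x + Pi.single 1 1) x)) ∧ (∀ y f : Site 2, y ∈ (Λ δ).zdArcB → cornerObs (Λ δ) δ y f = 0) ∧ (∀ x y f : Site 2, s(x, y) ∈ (discreteDomainGraph (Λ δ).Ω (Λ δ).δ).edgeSet → y ∈ (Λ δ).zdArcB → x ∉ (Λ δ).zdArcA → x ∉ (Λ δ).zdArcB → (Λ δ).IsInnerFace f → IsCorner x f → IsCorner y f → cornerObs (Λ δ) δ x f = cornerPhase δ (Λ δ) x f (Set.univ : BondConfig (Site 2)) * ((bondPercolation (zdGraph 2) half).real {ω | ∃ a ∈ (Λ δ).zdArcA, (openGraph ((Λ δ).bcBondConfig ω)).Reachable x a} : ℂ) ∧ (bondPercolation (zdGraph 2) half).real {ω | ∃ k : ℕ, (medialExploration (Λ δ) ω)[k]? = some (cornerSource x f) ∧ (medialExploration (Λ δ) ω)[k + 1]? = some (cornerTarget x f)}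 = (bondPercolation (zdGraph 2) half).real {ω | ∃ a ∈ (Λ δ).zdArcA, (openGraph ((Λ δ).bcBondConfig ω)).Reachable x a} ∧ ‖cornerPhase δ (Λ δ) x f (Set.univ : BondConfig (Site 2))‖ ≤ 1 ∧ (0 < (bondPercolation (zdGraph 2) half).real {ω | ∃ a ∈ (Λ δ).zdArcA, (openGraph ((Λ δ).bcBondConfig ω)).Reachable x a} → ‖cornerPhase δ (Λ δ) x f (Set.univ : BondConfig (Site 2))‖ = 1)) ∧ (∀ y y' f : Site 2, s(y, y') ∈ (discreteDomainGraph (Λ δ).Ω (Λ δ).δ).edgeSet → y ∈ (Λ δ).zdArcA → y' ∈ (Λ δ).zdArcA → (Λ δ).IsInnerFace f → IsCorner y f → IsCorner y' f → (∀ f' : Site 2, (Λ δ).IsInnerFace f' → IsCorner y f' → IsCorner y' f' → f' = f) → cornerObs (Λ δ) δ y f = cornerPhase δ (Λ δ) y f (∅ : BondConfig (Site 2)) * ((bondPercolation (zdGraph 2) half).real {ω | ∃ k : ℕ, (medialExploration (Λ δ) ω)[k]? = some (cornerSource y f) ∧ (medialExploration (Λ δ) ω)[k + 1]? = some (cornerTarget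 y f)} : ℂ) ∧ ‖cornerPhase δ (Λ δ) y f (∅ : BondConfig (Site 2))‖ ≤ 1 ∧ (0 < (bondPercolation (zdGraph 2) half).real {ω | ∃ k : ℕ, (medialExploration (Λ δ) ω)[k]? = some (cornerSource y f) ∧ (medialExploration (Λ δ) ω)[k + 1]? = some (cornerTarget y f)} → ‖cornerPhase δ (Λ δ) y f (∅ : BondConfig (Site 2))‖ = 1)) := by
  refine ⟨Complex.I, Or.inl rfl, fun D Λ hΛ => ?_⟩
  obtain ⟨hΩ, -, -, -, -, hadm⟩ := hΛ
  filter_upwards [hadm, self_mem_nhdsWithin] with δ hE hδ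
  have hδ' : (0:ℝ) < δ := hδ
  have hH : HoleFree {f : Site 2 | (Λ δ).IsInnerFace f} := holeFree_innerFaces D.toJordanDomain (hΩ δ) hE.delta_pos
  refine ⟨fun x he hxA hxB hxA' hxB' => CornerForm.halfCR_horizontal D (Λ δ) (hΩ δ) hE x he hxA hxB hxA' hxB' δ hδ',
    fun x he hxA hxB hxA' hxB' => CornerForm.halfCR_vertical D (Λ δ) (hΩ δ) hE x he hxA hxB hxA' hxB' δ hδ',
    fun y f hy => CornerForm.cornerObs_eq_zero_of_mem_zdArcB hE δ hy f,
    fun x y f _ hyB _ _ hf hx hy => CornerForm.freeArc_touch_law hE hH hδ'.ne' hf hx hy hyB,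
    fun y y' f _ hyA _ _ hyf _ _ => CornerForm.wiredArc_law hE hH hδ'.ne' hyf hyA⟩

end Summit.CriticalPhenomena.CardyFormulaZ2.Theorems.ParafermionFamiliesToSLESix.StripAnchored

end
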